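import Literature.Analysis.FluidPDE.HardSphereCollisionRecord
import Literature.MathematicalPhysics.KineticTheory.HardSphereEuler

/-!
# Line `birth` of `TwoClocks.EquilibriumFastWindowLD` (stmt-AtomisticToContinuum-14440): the two matchings of a
# collision record (helpers of the D₄ audit, rev 3)

Two closed kinematic facts about a hard-sphere collision record read off a configuration
(`HardSphereCollisionRecord.ofConfig`: post-collisional velocities `p = (v⁺, v_*⁺)`, pre-collisional
velocities `reflectVel n p = (v⁻, v_*⁻)`, `n` the separation vector), used by the audit of the registered
stub `stub_nonRetainedCensus` (D₄) of the skeleton `Cruxes/EquilibriumFastWindowLD/Lines/birth.lean`: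

* `ccb4_reflectVel_matchings_sq` — **Pythagoras of the two matchings**: the incoming relative velocity
  splits orthogonally into the kick `v⁺ − v⁻` (normal component) and the "exchange" difference
  `v⁺ − v_*⁻` (tangential component), `‖v⁻ − v_*⁻‖² = ‖v⁺ − v⁻‖² + ‖v⁺ − v_*⁻‖²`, for EVERY impact vector
  (junk `n = 0` included: then the kick vanishes);
* `ccb4_record_sqrt_tangential_eq` — consequently the D₄ summand
  `√(‖v⁻ − v_*⁻‖² − ‖v⁺ − v⁻‖²)` of a record of the crux's flow is never `Real.sqrt`-junk: it equals
  `‖v⁺ − v_*⁻‖`, the distance of the second matching of the outgoing to the incoming pair, so that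
  `min(kick, √…) = min(‖v_i⁺ − v_i⁻‖, ‖v_i⁺ − v_j⁻‖)` as the transfer stub T uses it.

prover-line-stmt-AtomisticToContinuum-14440-a1-0 (stub worker D₄), 2026-08-17.
-/

noncomputable section

open MeasureTheory
open scoped ENNReal BigOperators InnerProductSpace

namespace Summit.AtomisticToContinuum.HydrodynamicLimit.Theorems.ClampedCorrectorBirth

open Literature.Analysis.FluidPDE Literature.MathematicalPhysics.KineticTheory

/-- **Pythagoras of the two matchings of an elastic collision.** For the reflection law
`reflectVel n p = (p.1 − a•n, p.2 + a•n)`, `a = ⟪p.1 − p.2, n⟫/‖n‖²`, the relative velocity of the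
reflected pair decomposes orthogonally into the kick `p.1 − (reflectVel n p).1 = a•n` and the tangential
difference `p.1 − (reflectVel n p).2 = (p.1 − p.2) − a•n ⊥ n`:
`‖(reflectVel n p).1 − (reflectVel n p).2‖² = ‖p.1 − (reflectVel n p).1‖² + ‖p.1 − (reflectVel n p).2‖²`
(also at the junk value `n = 0`, where the kick is `0`). [folklore] -/
theorem ccb4_reflectVel_matchings_sq : ∀ (n : V3) (p : V3 × V3),
    ‖(reflectVel n p).1 - (reflectVel n p).2‖ ^ 2 =
      ‖p.1 - (reflectVel n p).1‖ ^ 2 + ‖p.1 - (reflectVel n p).2‖ ^ 2 := by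
  intro n p
  by_cases hn : n = 0
  · subst hn
    simp
  set a : ℝ := ⟪p.1 - p.2, n⟫_ℝ / ‖n‖ ^ 2 with ha
  have hn2 : ‖n‖ ^ 2 ≠ 0 := pow_ne_zero 2 (norm_ne_zero_iff.2 hn)
  have han : a * ‖n‖ ^ 2 = ⟪p.1 - p.2, n⟫_ℝ := by rw [ha, div_mul_cancel₀ _ hn2]
  have h1 : (reflectVel n p).1 - (reflectVel n p).2 = (p.1 - p.2) - (2 * a) • n := by
    simp only [reflectVel, ← ha, mul_smul, two_smul]
    abel
  have h2 : p.1 - (reflectVel n p).1 = a • n := by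
    simp only [reflectVel, ← ha]
    abel
  have h3 : p.1 - (reflectVel n p).2 = (p.1 - p.2) - a • n := by
    simp only [reflectVel, ← ha]
    abel
  have e1 : ‖(p.1 - p.2) - (2 * a) • n‖ ^ 2 =
      ‖p.1 - p.2‖ ^ 2 - 2 * ((2 * a) * ⟪p.1 - p.2, n⟫_ℝ) + (2 * a) ^ 2 * ‖n‖ ^ 2 := by
    rw [norm_sub_sq_real, inner_smul_right, norm_smul, mul_pow, Real.norm_eq_abs, sq_abs]
  have e2 : ‖(p.1 - p.2) - a • n‖ ^ 2 =
      ‖p.1 - p.2‖ ^ 2 - 2 * (a * ⟪p.1 - p.2, n⟫_ℝ) + a ^ 2 * ‖n‖ ^ 2 := by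
    rw [norm_sub_sq_real, inner_smul_right, norm_smul, mul_pow, Real.norm_eq_abs, sq_abs]
  have e3 : ‖a • n‖ ^ 2 = a ^ 2 * ‖n‖ ^ 2 := by
    rw [norm_smul, mul_pow, Real.norm_eq_abs, sq_abs]
  rw [h1, h2, h3, e1, e2, e3]
  linear_combination (2 * a) * han

/-- **The D₄ square root is the second matching.** For every record read off a configuration of the
crux's hard-sphere flow (`N + 1` spheres of diameter `hsDiameter σ N` on `𝕋³`; these are exactly the
records summed by `HardSphereFlow.collisionSum`), the argument of the square root in the kinematic
census `ψ` of `stub_nonRetainedCensus` is nonnegative and the square root equals the distance of the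
second matching of the outgoing to the incoming pair:
`√(‖v⁻ − v_*⁻‖² − ‖v⁺ − v⁻‖²) = ‖v⁺ − v_*⁻‖` (`ccb4_reflectVel_matchings_sq`, `Real.sqrt_sq`). [folklore] -/
theorem ccb4_record_sqrt_tangential_eq : ∀ (σ : ℝ) (N : ℕ) (z : Config (N + 1) (Fin 3) T3) (t : ℝ)
    (i j : Fin (N + 1)),
    Real.sqrt (‖(HardSphereCollisionRecord.ofConfig (Torus.geometry (Fin 3)) (hsDiameter σ N) z t i j).preVel.1 -
          (HardSphereCollisionRecord.ofConfig (Torus.geometry (Fin 3)) (hsDiameter σ N) z t i j).preVel.2‖ ^ 2 -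
        ‖(HardSphereCollisionRecord.ofConfig (Torus.geometry (Fin 3)) (hsDiameter σ N) z t i j).postVel.1 -
          (HardSphereCollisionRecord.ofConfig (Torus.geometry (Fin 3)) (hsDiameter σ N) z t i j).preVel.1‖ ^ 2) =
      ‖(HardSphereCollisionRecord.ofConfig (Torus.geometry (Fin 3)) (hsDiameter σ N) z t i j).postVel.1 -
        (HardSphereCollisionRecord.ofConfig (Torus.geometry (Fin 3)) (hsDiameter σ N) z t i j).preVel.2‖ := by
  intro σ N z t i j
  simp only [HardSphereCollisionRecord.ofConfig_preVel, HardSphereCollisionRecord.ofConfig_postVel]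
  rw [ccb4_reflectVel_matchings_sq, add_sub_cancel_left, Real.sqrt_sq (norm_nonneg _)]

end Summit.AtomisticToContinuum.HydrodynamicLimit.Theorems.ClampedCorrectorBirth

end
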